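import Summits.QuantumFields.BalabanUV.Beta.FP.SliceBiStencil
import Summits.QuantumFields.BalabanUV.Beta.FP.SliceGaugeLaw

/-!
# `BalabanUV.Beta.FP.SliceBiStencilWard` — road «FP» for binder row D1, row H2V-2 part 6 ∕ sub-row H2-ASM-5a «layer b» (owner «GO sliceW4», CLAIMS 2026-08-21 l.28064 (1)):
# THE (a8) LETTER OF THE BF SLICE PAIR `(sliceA, sliceW)` ON `ℤ⁴`: `divW (sliceW 3) y ν y′ = comp ((−1)•Π_y) (sliceA 3 ν y′) − comp (sliceA 3 ν y′) ((−1)•Π_y)` — the pure-gauge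
# divergence of the second-order table in its first bond IS the commutator of the first-order family with the site projection, with the SAME constant `c = 1` as the (a4) letter
# `SliceGaugeLaw.divV_sliceA` — the kernel certificate of `sliceW`'s SIGN and normalisation

HONEST DEPENDENCY (page 1, mandatory): continuum YM on T⁴ ⇐ BetaPertH ∧ nine spine estimates (0/9 proved); BetaPertH ⇐ (D1) ∧ (D4) ∧ CAP+tail;
G-an2-4 gates asym, D1 and NE2/3/4.  HONEST FRAMING (cell contract, verbatim): «discharging `BetaPertH` makes Bałaban's UV stability UNCONDITIONAL —
a real constructive-QFT result; it is NOT the continuum limit and NOT the Clay problem.»  THIS MODULE DISCHARGES NOTHING of the wall: finite indicator algebra over the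
closed forms `SliceBiStencil.sliceW_inl_inl_apply` ✓ and `SliceVertex.sEntry_apply` ✓ and gan24-leaf-02's `SliceGaugeLaw.commutator_proj_apply` ✓; no `def`, no `def … : Prop`,
nothing cited, no `sorry`; 0∕4 row-D1 binders; NOT (a8) for the perfect quartic jet (H2V-4′), NOT W2's (a4-total), NOT (Kcov), NOT D1, NOT BetaPertH, NOT continuum, NOT Clay.

ABSOLUTE RULE (cell charter, verbatim): «No internally-minted statement may enter as a cited fact. Every hypothesis is either kernel-proved in this package or a
verbatim quotation of a PUBLISHED theorem with page reference. The manuscript(s) under audit are NOT citable for their own disputed steps — they are the thing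
under adjudication; programme-internal (2001/route/tribunal) claims are never citable.»

WHAT IS PROVED (`d + 1 = 4`).  §1 `divW_apply`, the four `μ`-sums of the closed form at the shifted ∕ unshifted first bond (`sum_T_shift`, `sum_T_base`, `sum_D_shift`, `sum_D_base`:
the pair word collapses on `μ = a` ∕ `μ = b`, the same-bond word on `μ = ν`); §2 the field–field entry `divW_sliceW_inl_inl` and the vanishing of the other blocks; §3 **`divW_sliceW`** —
W2's hypothesis `hA8 : ∀ y ν y′, divW W y ν y′ = comp ((−c) • proj y) (V ν y′) − comp (V ν y′) ((−c) • proj y)` (`PerfectPolarizationWardLetters.wardTransversal_flip_PiBF_of_gauge_laws`)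
for the slice summand `(V, W) := (sliceA 3, sliceW 3)` with **`c = 1`**, the constant of `SliceGaugeLaw.divV_sliceA` — so (a4) and (a8) of `½|D*_B W|²` close with ONE constant
(background-gauge invariance differentiated once and twice); with `sliceW ↦ −sliceW` (the `A ↦ 1` instance without the colour sign of `SliceBiStencil`'s header) the constant would
be `−1`.  First found by exact enumeration (`HOME/b2b-balaban-beta-d1-formalise-leaf-02/g10/check_a8s.py`, 516 configurations); here for every `y, ν, y′`.
Provenance: D1 formalisation swarm seat b2b-balaban-beta-d1-formalise-leaf-02 gen 10 (road FP engine lineage), 2026-08-21.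
-/

noncomputable section

namespace Summit.QuantumFields.BalabanUV.Beta.FP.SliceBiStencilWard

open Finset
open scoped BigOperators
open Literature.MathematicalPhysics.QuantumFieldTheory.Balaban1983to89
open Literature.MathematicalPhysics.QuantumFieldTheory.Balaban1983to89.Beta
open B6BondElimination (unitVec unitVec_apply)
open ExpKernelCalculus (MKer Site comp)
open OneStepResolventKernel (Fib)
open KernelWard (divW)
open Summit.QuantumFields.BalabanUV.Beta.FP.PerfectPolarizationWardLetters (fmask fmask_inl fmask_inr proj)
open Summit.QuantumFields.BalabanUV.Beta.FP.SliceGaugeLaw (commutator_proj_apply)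
open Summit.QuantumFields.BalabanUV.Beta.FP.SliceVertex (sEntry sEntry_apply sliceA sliceA_inl_inl)
open Summit.QuantumFields.BalabanUV.Beta.FP.SliceBiStencil (sliceW sliceW_inl_inl_apply)

/-! ## §1 The pure-gauge divergence entrywise and the four `μ`-sums -/

/-- [folklore] `divW` entrywise. -/
theorem divW_apply (W : Fin 4 → Site 4 → Fin 4 → Site 4 → MKer 4 (Fib 3)) (y : Site 4) (ν : Fin 4) (y' x z : Site 4) (a b : Fib 3) :
    divW W y ν y' x z a b = ∑ μ : Fin 4, (W μ (y - unitVec μ) ν y' x z a b - W μ y ν y' x z a b) := by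
  unfold divW
  simp only [Finset.sum_apply, Pi.sub_apply]

/-- [folklore] the pair word summed over the SHIFTED first bond `(μ, y − e_μ)`: the bond ends at `y`, the pin collapses on `μ = a` ∕ `μ = b`. -/
theorem sum_T_shift (y p x z : Site 4) (ν : Fin 4) (y' : Site 4) (a b : Fin 4) :
    ∑ μ : Fin 4, (if y - unitVec μ + unitVec μ = p then (1 : ℝ) else 0) *
        ((if x = y - unitVec μ ∧ a = μ then (1 : ℝ) else 0) * (if z = y' ∧ b = ν then 1 else 0)
          + (if z = y - unitVec μ ∧ b = μ then (1 : ℝ) else 0) * (if x = y' ∧ a = ν then 1 else 0)) =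
      (if y = p then (1 : ℝ) else 0) * ((if x = y - unitVec a then (1 : ℝ) else 0) * (if z = y' ∧ b = ν then 1 else 0)
          + (if z = y - unitVec b then (1 : ℝ) else 0) * (if x = y' ∧ a = ν then 1 else 0)) := by
  simp only [sub_add_cancel, ← Finset.mul_sum, Finset.sum_add_distrib]
  congr 1
  rw [Finset.sum_eq_single_of_mem a (Finset.mem_univ a) (fun μ _ hμ => by rw [if_neg (fun h => hμ h.2.symm), zero_mul]),
    Finset.sum_eq_single_of_mem b (Finset.mem_univ b) (fun μ _ hμ => by rw [if_neg (fun h => hμ h.2.symm), zero_mul])]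
  simp only [and_true]

/-- [folklore] the pair word summed over the UNSHIFTED first bond `(μ, y)`. -/
theorem sum_T_base (y p x z : Site 4) (ν : Fin 4) (y' : Site 4) (a b : Fin 4) :
    ∑ μ : Fin 4, (if y + unitVec μ = p then (1 : ℝ) else 0) *
        ((if x = y ∧ a = μ then (1 : ℝ) else 0) * (if z = y' ∧ b = ν then 1 else 0)
          + (if z = y ∧ b = μ then (1 : ℝ) else 0) * (if x = y' ∧ a = ν then 1 else 0)) =
      (if y + unitVec a = p then (1 : ℝ) else 0) * (if x = y then (1 : ℝ) else 0) * (if z = y' ∧ b = ν then 1 else 0)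
        + (if y + unitVec b = p then (1 : ℝ) else 0) * (if z = y then (1 : ℝ) else 0) * (if x = y' ∧ a = ν then 1 else 0) := by
  simp only [mul_add, Finset.sum_add_distrib]
  congr 1
  · rw [Finset.sum_eq_single_of_mem a (Finset.mem_univ a) (fun μ _ hμ => by rw [if_neg (fun h : x = y ∧ a = μ => hμ h.2.symm)]; ring)]
    simp only [and_true]; ring
  · rw [Finset.sum_eq_single_of_mem b (Finset.mem_univ b) (fun μ _ hμ => by rw [if_neg (fun h : z = y ∧ b = μ => hμ h.2.symm)]; ring)]
    simp only [and_true]; ring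

/-- [folklore] the same-bond word summed over the shifted first bond: collapses on `μ = ν`, `y − e_ν = y′`. -/
theorem sum_D_shift (y x z : Site 4) (ν : Fin 4) (y' : Site 4) (a b : Fin 4) :
    ∑ μ : Fin 4, (if y - unitVec μ = y' ∧ μ = ν then (1 : ℝ) else 0) *
        (sEntry 3 μ (y - unitVec μ) z x b a + sEntry 3 μ (y - unitVec μ) x z a b) =
      (if y - unitVec ν = y' then (1 : ℝ) else 0) * (sEntry 3 ν y' z x b a + sEntry 3 ν y' x z a b) := by
  rw [Finset.sum_eq_single_of_mem ν (Finset.mem_univ ν) (fun μ _ hμ => by rw [if_neg (fun h => hμ h.2), zero_mul])]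
  by_cases h : y - unitVec ν = y'
  · rw [if_pos ⟨h, rfl⟩, if_pos h, h]
  · rw [if_neg (fun h' => h h'.1), if_neg h, zero_mul, zero_mul]

/-- [folklore] the same-bond word summed over the unshifted first bond: collapses on `μ = ν`, `y = y′`. -/
theorem sum_D_base (y x z : Site 4) (ν : Fin 4) (y' : Site 4) (a b : Fin 4) :
    ∑ μ : Fin 4, (if y = y' ∧ μ = ν then (1 : ℝ) else 0) * (sEntry 3 μ y z x b a + sEntry 3 μ y x z a b) =
      (if y = y' then (1 : ℝ) else 0) * (sEntry 3 ν y' z x b a + sEntry 3 ν y' x z a b) := by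
  rw [Finset.sum_eq_single_of_mem ν (Finset.mem_univ ν) (fun μ _ hμ => by rw [if_neg (fun h => hμ h.2), zero_mul])]
  by_cases h : y = y'
  · rw [if_pos ⟨h, rfl⟩, if_pos h, h]
  · rw [if_neg (fun h' => h h'.1), if_neg h, zero_mul, zero_mul]

/-! ## §2 The field–field entry -/

/-- [folklore] **THE FIELD–FIELD ENTRY OF THE (a8) LETTER**:
`(divW (sliceW 3) y ν y′) x z (inl a) (inl b) = [z = y]·(sliceA 3 ν y′) x y (inl a) (inl b) − [x = y]·(sliceA 3 ν y′) y z (inl a) (inl b)`. -/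
theorem divW_sliceW_inl_inl (y : Site 4) (ν : Fin 4) (y' x z : Site 4) (a b : Fin 4) :
    divW (sliceW 3) y ν y' x z (Sum.inl a) (Sum.inl b) =
      (if z = y then (1 : ℝ) else 0) * sliceA 3 ν y' x y (Sum.inl a) (Sum.inl b)
        - (if x = y then (1 : ℝ) else 0) * sliceA 3 ν y' y z (Sum.inl a) (Sum.inl b) := by
  rw [divW_apply]
  simp only [sliceW_inl_inl_apply, Finset.sum_sub_distrib, Finset.sum_add_distrib, Finset.sum_neg_distrib]
  have e1 : ∀ μ : Fin 4, (2 : ℝ)⁻¹ * (if y - unitVec μ = y' ∧ μ = ν then (1 : ℝ) else 0) *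
      (sEntry 3 μ (y - unitVec μ) z x b a + sEntry 3 μ (y - unitVec μ) x z a b) =
      (2 : ℝ)⁻¹ * ((if y - unitVec μ = y' ∧ μ = ν then (1 : ℝ) else 0) * (sEntry 3 μ (y - unitVec μ) z x b a + sEntry 3 μ (y - unitVec μ) x z a b)) :=
    fun μ => by ring
  have e2 : ∀ μ : Fin 4, (2 : ℝ)⁻¹ * (if y = y' ∧ μ = ν then (1 : ℝ) else 0) * (sEntry 3 μ y z x b a + sEntry 3 μ y x z a b) =
      (2 : ℝ)⁻¹ * ((if y = y' ∧ μ = ν then (1 : ℝ) else 0) * (sEntry 3 μ y z x b a + sEntry 3 μ y x z a b)) := fun μ => by ring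
  simp only [e1, e2, ← Finset.mul_sum]
  rw [sum_T_shift, sum_T_base, sum_D_shift, sum_D_base, sliceA_inl_inl, sliceA_inl_inl]
  have px : (if x = y then (1 : ℝ) else 0) * (1 / 2 * (sEntry 3 ν y' y z a b - sEntry 3 ν y' z y b a)) =
      (if x = y then (1 : ℝ) else 0) * (1 / 2 * (sEntry 3 ν y' x z a b - sEntry 3 ν y' z x b a)) := by
    by_cases h : x = y
    · rw [h]
    · rw [if_neg h, zero_mul, zero_mul]
  have pz : (if z = y then (1 : ℝ) else 0) * (1 / 2 * (sEntry 3 ν y' x y a b - sEntry 3 ν y' y x b a)) =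
      (if z = y then (1 : ℝ) else 0) * (1 / 2 * (sEntry 3 ν y' x z a b - sEntry 3 ν y' z x b a)) := by
    by_cases h : z = y
    · rw [h]
    · rw [if_neg h, zero_mul, zero_mul]
  rw [px, pz]
  simp only [sEntry_apply]
  -- atoms: relations among the pinned indicators
  have r1 : (if y = y' + unitVec ν then (1 : ℝ) else 0) * (if x = y - unitVec a then (1 : ℝ) else 0) =
      (if y = y' + unitVec ν then (1 : ℝ) else 0) * (if x = y' + unitVec ν - unitVec a then (1 : ℝ) else 0) := by
    by_cases h : y = y' + unitVec ν
    · rw [if_pos h, h]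
    · rw [if_neg h, zero_mul, zero_mul]
  have r2 : (if y = y' + unitVec ν then (1 : ℝ) else 0) * (if z = y - unitVec b then (1 : ℝ) else 0) =
      (if y = y' + unitVec ν then (1 : ℝ) else 0) * (if z = y' + unitVec ν - unitVec b then (1 : ℝ) else 0) := by
    by_cases h : y = y' + unitVec ν
    · rw [if_pos h, h]
    · rw [if_neg h, zero_mul, zero_mul]
  have r3 : (if y + unitVec a = y' + unitVec ν then (1 : ℝ) else 0) * (if x = y then (1 : ℝ) else 0) =
      (if x = y' + unitVec ν - unitVec a then (1 : ℝ) else 0) * (if x = y then (1 : ℝ) else 0) := by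
    by_cases h : x = y
    · rw [if_pos h, h]
      have e : (y + unitVec a = y' + unitVec ν) ↔ (y = y' + unitVec ν - unitVec a) := eq_sub_iff_add_eq.symm
      simp only [e]
    · rw [if_neg h, mul_zero, mul_zero]
  have r4 : (if y + unitVec b = y' + unitVec ν then (1 : ℝ) else 0) * (if z = y then (1 : ℝ) else 0) =
      (if z = y' + unitVec ν - unitVec b then (1 : ℝ) else 0) * (if z = y then (1 : ℝ) else 0) := by
    by_cases h : z = y
    · rw [if_pos h, h]
      have e : (y + unitVec b = y' + unitVec ν) ↔ (y = y' + unitVec ν - unitVec b) := eq_sub_iff_add_eq.symm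
      simp only [e]
    · rw [if_neg h, mul_zero, mul_zero]
  have flip : ∀ (p q : Site 4), (if p = q then (1 : ℝ) else 0) = (if q = p then (1 : ℝ) else 0) := by
    intro p q
    by_cases h : p = q
    · rw [if_pos h, if_pos h.symm]
    · rw [if_neg h, if_neg (fun h' => h h'.symm)]
  have r5 : (if z = y then (1 : ℝ) else 0) * (if z = y' ∧ b = ν then (1 : ℝ) else 0) =
      (if y = y' then (1 : ℝ) else 0) * (if z = y' ∧ b = ν then (1 : ℝ) else 0) := by
    by_cases h : z = y' ∧ b = ν
    · rw [if_pos h, h.1, flip y' y]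
    · rw [if_neg h, mul_zero, mul_zero]
  have r6 : (if x = y then (1 : ℝ) else 0) * (if x = y' ∧ a = ν then (1 : ℝ) else 0) =
      (if y = y' then (1 : ℝ) else 0) * (if x = y' ∧ a = ν then (1 : ℝ) else 0) := by
    by_cases h : x = y' ∧ a = ν
    · rw [if_pos h, h.1, flip y' y]
    · rw [if_neg h, mul_zero, mul_zero]
  have r7 : (if x = y then (1 : ℝ) else 0) * (if x = y' + unitVec ν then (1 : ℝ) else 0) =
      (if y = y' + unitVec ν then (1 : ℝ) else 0) * (if x = y' + unitVec ν then (1 : ℝ) else 0) := by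
    by_cases h : x = y' + unitVec ν
    · rw [if_pos h, h, flip (y' + unitVec ν) y]
    · rw [if_neg h, mul_zero, mul_zero]
  have r8 : (if z = y then (1 : ℝ) else 0) * (if z = y' + unitVec ν then (1 : ℝ) else 0) =
      (if y = y' + unitVec ν then (1 : ℝ) else 0) * (if z = y' + unitVec ν then (1 : ℝ) else 0) := by
    by_cases h : z = y' + unitVec ν
    · rw [if_pos h, h, flip (y' + unitVec ν) y]
    · rw [if_neg h, mul_zero, mul_zero]
  have isub : ∀ (c : Prop) [Decidable c] (p q : ℝ), (if c then p - q else 0) = (if c then (1 : ℝ) else 0) * (p - q) := by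
    intro c _ p q; split_ifs <;> ring
  simp only [isub]
  have e3 : (y - unitVec ν = y') ↔ (y = y' + unitVec ν) := sub_eq_iff_eq_add
  simp only [e3]
  linear_combination (-(if z = y' ∧ b = ν then (1 : ℝ) else 0)) * r1 + (-(if x = y' ∧ a = ν then (1 : ℝ) else 0)) * r2
    + (if z = y' ∧ b = ν then (1 : ℝ) else 0) * r3 + (if x = y' ∧ a = ν then (1 : ℝ) else 0) * r4
    + (-((if x = y' + unitVec ν then (1 : ℝ) else 0) - (if x = y' + unitVec ν - unitVec a then (1 : ℝ) else 0))) * r5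
    + (-((if z = y' + unitVec ν then (1 : ℝ) else 0) - (if z = y' + unitVec ν - unitVec b then (1 : ℝ) else 0))) * r6
    + (if z = y' ∧ b = ν then (1 : ℝ) else 0) * r7 + (if x = y' ∧ a = ν then (1 : ℝ) else 0) * r8

/-! ## §3 The (a8) letter -/

/-- [our object] **THE (a8) LETTER OF THE BF SLICE, CONSTANT `c = 1`**: `divW (sliceW 3) y ν y′ = comp ((−1) • proj y) (sliceA 3 ν y′) − comp (sliceA 3 ν y′) ((−1) • proj y)` —
verbatim the hypothesis `hA8` of `PerfectPolarizationWardLetters.wardTransversal_flip_PiBF_of_gauge_laws` for the slice summand, with the SAME `c = 1` as (a4)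
`SliceGaugeLaw.divV_sliceA`. -/
theorem divW_sliceW (y : Site 4) (ν : Fin 4) (y' : Site 4) :
    divW (sliceW 3) y ν y' = comp ((-1 : ℝ) • proj y) (sliceA 3 ν y') - comp (sliceA 3 ν y') ((-1 : ℝ) • proj y) := by
  have hc : comp ((-1 : ℝ) • proj y) (sliceA 3 ν y') - comp (sliceA 3 ν y') ((-1 : ℝ) • proj y)
      = comp (sliceA 3 ν y') (proj y) - comp (proj y) (sliceA 3 ν y') := by
    rw [KernelReflection.comp_smul_left, KernelReflection.comp_smul_right]
    funext x z a b
    simp only [Pi.sub_apply, Pi.smul_apply, smul_eq_mul]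
    ring
  rw [hc]
  funext x z a b
  rw [commutator_proj_apply]
  rcases a with a | i <;> rcases b with b | j
  · rw [divW_sliceW_inl_inl, fmask_inl, fmask_inl]; ring
  all_goals
    rw [divW_apply]
    simp [sliceA, sliceW]

end Summit.QuantumFields.BalabanUV.Beta.FP.SliceBiStencilWard

end
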